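import Summits.Schanuel.Schanuel.Theorems.ZilberEacComplexHypersurfaceEscape
import HarnessLib

/-!
# EC over every ellipsoid-type quadric base, with no lattice hypothesis

Application of Theorem H_esc (`ZilberEacComplexHypersurfaceEscape.lean`; Exponential-Algebraic Closedness
by linear escape over an arbitrary hypersurface base; first open rung `dim π₁(V) = n - 1`, Mantova–Masser,
PLMS 129 (2024), §1 p. 5) in which the lattice hypothesis is DISCHARGED once and for all: the bases
`B = {Σᵢ aᵢxᵢ² + Σᵢ bᵢxᵢ + c₀ = 0} ⊆ ℂⁿ` with POSITIVE real `aᵢ` (complex spheres, ellipsoids, their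
affine perturbations; `b ∈ ℂⁿ`, `c₀ ∈ ℂ` arbitrary), `n ≥ 2`, ANY fibre direction `ν ∈ ℤⁿ ∖ 0` and every
Laurent-parametrised escape family `yᵢ = cᵢ t^{νᵢ} + Σ_{m<νᵢ} A_{i,m}(x) tᵐ`. The point: a positive-definite
leading form `Q` is never Gårding-hyperbolic, and concretely for `q = e_{j₁}` (`j₁ ≠ j₀`, `ν_{j₀} ≠ 0`) the
lattice polynomial `Q(λν + 2πiq) = Aλ² + 4πi a_{j₁}ν_{j₁} λ - 4π² a_{j₁}` (`A = Σ aᵢνᵢ²`) has the simple root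
`λ = (2π/A)(√Δ - i a_{j₁}ν_{j₁})`, `Δ = a_{j₁}(A - a_{j₁}ν_{j₁}²) > 0`, with `Re λ > 0` and
`Σ νₖ∂ₖQ(v) = 4π√Δ ≠ 0`. This extends the packet's sphere theorem (Theorem S: `Σxᵢ² = r`, puncture fibres)
to all such bases and to escape/Laurent fibres of every direction.

* `exists_expPoint_ellipsoidEscape` — **EC for the class above**, hypothesis-free.

HONEST FRAMING: a modest new sub-rung of EAC; nothing here bears on Schanuel's conjecture; EC(3,2) open.
-/

noncomputable section

open Complex MvPolynomial Metric Set Filter Topology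

set_option linter.dupNamespace false

namespace Summit.Schanuel.Schanuel.Theorems

/-- **EC over ellipsoid-type quadric bases, no lattice hypothesis.** Let `n ≥ 2`, `aᵢ > 0` real,
`b ∈ ℂⁿ`, `c₀ ∈ ℂ`, `ν ∈ ℤⁿ` non-zero, `cᵢ ≠ 0`, `Sᵢ ⊆ ℤ` finite below `νᵢ`, `A_{i,m} ∈ ℂ[x]` arbitrary.
Then there are `x ∈ ℂⁿ` with `Σ aᵢxᵢ² + Σ bᵢxᵢ + c₀ = 0` and `L ∈ ℂ` with
`e^{xᵢ} = cᵢ e^{νᵢL} + Σ_{m ∈ Sᵢ} A_{i,m}(x) e^{mL}` for all `i`: the `n`-fold swept over the quadric by the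
escape fibres (`dim π₁ V = n - 1`, first open range of Exponential-Algebraic Closedness, Mantova–Masser
2024 §1 p. 5) meets the graph of `exp`. Theorem H_esc with `q = e_{j₁}` and the explicit simple root
`λ = (2π/A)(√Δ - i a_{j₁}ν_{j₁})`. New. [cite: MantovaMasser2023, §1 p.5 (the open case dim π(V) = 2
in ℂ³×ℂˣ³)] -/
theorem exists_expPoint_ellipsoidEscape {n : ℕ} (a : Fin n → ℝ) (ha : ∀ i, 0 < a i) (b : Fin n → ℂ)
    (c₀ : ℂ) (ν : Fin n → ℤ) {j₀ j₁ : Fin n} (hj : j₀ ≠ j₁) (hν : ν j₀ ≠ 0)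
    (c : Fin n → ℂ) (hc : ∀ i, c i ≠ 0) (S : Fin n → Finset ℤ) (hS : ∀ i, ∀ m ∈ S i, m < ν i)
    (A : Fin n → ℤ → MvPolynomial (Fin n) ℂ) :
    ∃ x : Fin n → ℂ, ∃ L : ℂ, (∑ i, (a i : ℂ) * x i ^ 2 + ∑ i, b i * x i + c₀ = 0) ∧ ∀ i,
      exp (x i) = c i * exp ((ν i : ℂ) * L) + ∑ m ∈ S i, eval x (A i m) * exp ((m : ℂ) * L) := by
  classical
  -- the base polynomial and its homogeneous pieces
  set QF : MvPolynomial (Fin n) ℂ := ∑ i, C (a i : ℂ) * X i ^ 2 with hQF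
  set Lin : MvPolynomial (Fin n) ℂ := ∑ i, C (b i) * X i + C c₀ with hLin
  set H : MvPolynomial (Fin n) ℂ := QF + Lin with hH
  have hQFhom : QF.IsHomogeneous 2 := by
    rw [hQF]
    refine IsHomogeneous.sum _ _ _ fun i _ => ?_
    simpa using (isHomogeneous_C (Fin n) (a i : ℂ)).mul (isHomogeneous_X_pow (R := ℂ) i 2)
  have hLinhom1 : (∑ i, C (b i) * X i : MvPolynomial (Fin n) ℂ).IsHomogeneous 1 := by
    refine IsHomogeneous.sum _ _ _ fun i _ => ?_
    simpa using (isHomogeneous_C (Fin n) (b i)).mul (isHomogeneous_X ℂ i)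
  have hevalQF : ∀ x : Fin n → ℂ, eval x QF = ∑ i, (a i : ℂ) * x i ^ 2 := fun x => by
    simp [hQF, map_sum, map_mul, map_pow, eval_C, eval_X]
  have hevalH : ∀ x : Fin n → ℂ, eval x H = ∑ i, (a i : ℂ) * x i ^ 2 + ∑ i, b i * x i + c₀ :=
    fun x => by
    simp only [hH, hLin, map_add, hevalQF, map_sum, map_mul, eval_C, eval_X]
    ring
  -- `A = Σ aᵢνᵢ² > 0`
  set Aν : ℝ := ∑ i, a i * (ν i : ℝ) ^ 2 with hAν
  have hAν0 : 0 < Aν := by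
    have h1 : a j₀ * (ν j₀ : ℝ) ^ 2 ≤ Aν :=
      Finset.single_le_sum (f := fun i => a i * (ν i : ℝ) ^ 2)
        (fun i _ => mul_nonneg (ha i).le (sq_nonneg _)) (Finset.mem_univ j₀)
    have h2 : 0 < a j₀ * (ν j₀ : ℝ) ^ 2 := by
      have : (ν j₀ : ℝ) ≠ 0 := by exact_mod_cast hν
      exact mul_pos (ha j₀) (by positivity)
    linarith
  have hQF0 : QF ≠ 0 := by
    intro h
    have := hevalQF fun i => (ν i : ℂ)
    rw [h, map_zero] at this
    have : (Aν : ℂ) = 0 := by rw [hAν]; push_cast; rw [this]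
    exact hAν0.ne' (by exact_mod_cast this)
  have hQFdeg : QF.totalDegree = 2 := hQFhom.totalDegree hQF0
  have hLindeg : Lin.totalDegree ≤ 1 := by
    rw [hLin]
    refine (totalDegree_add _ _).trans (max_le hLinhom1.totalDegree_le ?_)
    rw [totalDegree_C]; norm_num
  have hHdeg : H.totalDegree = 2 := by
    rw [hH, totalDegree_add_eq_left_of_totalDegree_lt, hQFdeg]
    rw [hQFdeg]; omega
  have hHD : homogeneousComponent H.totalDegree H = QF := by
    rw [hHdeg, hH, map_add, homogeneousComponent_eq_self hQFhom, hLin, map_add,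
      homogeneousComponent_of_mem hLinhom1, homogeneousComponent_of_mem (isHomogeneous_C (Fin n) c₀)]
    simp
  have hpd : ∀ k x, eval x (pderiv k QF) = 2 * (a k : ℂ) * x k := by
    intro k x
    have key : ∀ i, eval x (pderiv k (C (a i : ℂ) * X i ^ 2)) =
        if i = k then 2 * (a k : ℂ) * x k else 0 := by
      intro i
      rw [pderiv_C_mul, map_mul, eval_C, pderiv_pow, pderiv_X]
      by_cases hik : i = k
      · subst hik; simp; ring
      · simp [hik]
    rw [hQF, map_sum, map_sum]
    simp_rw [key]
    rw [Finset.sum_ite_eq']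
    simp
  -- the lattice direction `q = e_{j₁}` and the root
  set Bq : ℝ := a j₁ * (ν j₁ : ℝ) with hBq
  set Δ : ℝ := a j₁ * (Aν - a j₁ * (ν j₁ : ℝ) ^ 2) with hΔ
  have hΔ0 : 0 < Δ := by
    have h1 : a j₀ * (ν j₀ : ℝ) ^ 2 + a j₁ * (ν j₁ : ℝ) ^ 2 ≤ Aν := by
      have hsub := Finset.sum_le_sum_of_subset_of_nonneg (f := fun i => a i * (ν i : ℝ) ^ 2)
        (Finset.subset_univ {j₀, j₁}) (fun i _ _ => mul_nonneg (ha i).le (sq_nonneg _))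
      rw [Finset.sum_pair hj] at hsub
      rw [hAν]; exact hsub
    have h2 : 0 < a j₀ * (ν j₀ : ℝ) ^ 2 := by
      have : (ν j₀ : ℝ) ≠ 0 := by exact_mod_cast hν
      exact mul_pos (ha j₀) (by positivity)
    have := ha j₁
    rw [hΔ]; nlinarith
  set sΔ : ℝ := Real.sqrt Δ with hsΔ
  have hsΔpos : 0 < sΔ := Real.sqrt_pos.mpr hΔ0
  have hsΔsq : sΔ * sΔ = Δ := Real.mul_self_sqrt hΔ0.le
  set k : ℝ := 2 * Real.pi / Aν with hk
  have hkpos : 0 < k := by positivity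
  have hkA : (k : ℂ) * (Aν : ℂ) = 2 * Real.pi := by
    rw [← Complex.ofReal_mul, hk, div_mul_cancel₀ _ hAν0.ne']; push_cast; ring
  have hkey : (sΔ : ℂ) ^ 2 + (Bq : ℂ) ^ 2 = (a j₁ : ℂ) * (Aν : ℂ) := by
    have h : sΔ ^ 2 + Bq ^ 2 = a j₁ * Aν := by rw [sq, hsΔsq, hΔ, hBq]; ring
    exact_mod_cast h
  set lam : ℂ := (k : ℂ) * ((sΔ : ℂ) - I * (Bq : ℂ)) with hlam
  have hre : 0 < lam.re := by
    have : lam.re = k * sΔ := by simp [hlam, Complex.mul_re]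
    rw [this]; positivity
  set q : Fin n → ℤ := fun i => if i = j₁ then 1 else 0 with hq
  set v : Fin n → ℂ := fun i => lam * (ν i : ℂ) + 2 * Real.pi * I * (q i : ℂ) with hv
  have hqC : ∀ i, (q i : ℂ) = if i = j₁ then 1 else 0 := by
    intro i; simp only [hq]; split_ifs <;> simp
  -- `Q(v) = A λ² + 4πi B λ - 4π² a_{j₁}`
  have hAνC : (∑ i, (a i : ℂ) * (ν i : ℂ) ^ 2) = (Aν : ℂ) := by rw [hAν]; push_cast; rfl
  have hBqC : (∑ i, (a i : ℂ) * (ν i : ℂ) * (q i : ℂ)) = (Bq : ℂ) := by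
    simp only [hqC, mul_ite, mul_one, mul_zero, Finset.sum_ite_eq', Finset.mem_univ, if_true, hBq]
    push_cast; ring
  have haq : (∑ i, (a i : ℂ) * (q i : ℂ) ^ 2) = (a j₁ : ℂ) := by
    simp only [hqC, ite_pow, one_pow, zero_pow two_ne_zero, mul_ite, mul_one, mul_zero,
      Finset.sum_ite_eq', Finset.mem_univ, if_true]
  have hQv : eval v QF = (Aν : ℂ) * lam ^ 2 + 4 * Real.pi * I * (Bq : ℂ) * lam -
      4 * Real.pi ^ 2 * (a j₁ : ℂ) := by
    rw [hevalQF]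
    have : ∀ i, (a i : ℂ) * v i ^ 2 = (a i : ℂ) * (ν i : ℂ) ^ 2 * lam ^ 2 +
        4 * Real.pi * I * lam * ((a i : ℂ) * (ν i : ℂ) * (q i : ℂ)) +
        (2 * Real.pi * I) ^ 2 * ((a i : ℂ) * (q i : ℂ) ^ 2) := by
      intro i; simp only [hv]; ring
    simp only [this, Finset.sum_add_distrib, ← Finset.sum_mul, ← Finset.mul_sum, hAνC, hBqC, haq]
    linear_combination (4 * (Real.pi : ℂ) ^ 2 * (a j₁ : ℂ)) * I_sq
  have hroot : eval (fun i => lam * (ν i : ℂ) + 2 * Real.pi * I * (q i : ℂ))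
      (homogeneousComponent H.totalDegree H) = 0 := by
    rw [hHD]
    change eval v QF = 0
    rw [hQv, hlam]
    linear_combination ((k : ℂ) * ((sΔ : ℂ) - I * (Bq : ℂ)) ^ 2 + 2 * Real.pi * (a j₁ : ℂ)) * hkA +
      (2 * Real.pi * (k : ℂ)) * hkey + (-(2 * Real.pi * (k : ℂ) * (Bq : ℂ) ^ 2)) * I_sq
  have hβ : ∑ i, (ν i : ℂ) * eval (fun i => lam * (ν i : ℂ) + 2 * Real.pi * I * (q i : ℂ))
      (pderiv i (homogeneousComponent H.totalDegree H)) ≠ 0 := by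
    rw [hHD]
    change ∑ i, (ν i : ℂ) * eval v (pderiv i QF) ≠ 0
    simp only [hpd]
    have e1 : ∑ i, (ν i : ℂ) * (2 * (a i : ℂ) * v i) =
        2 * (lam * ∑ i, (a i : ℂ) * (ν i : ℂ) ^ 2 +
          2 * Real.pi * I * ∑ i, (a i : ℂ) * (ν i : ℂ) * (q i : ℂ)) := by
      rw [Finset.mul_sum, Finset.mul_sum, ← Finset.sum_add_distrib, Finset.mul_sum]
      refine Finset.sum_congr rfl fun i _ => ?_
      simp only [hv]; ring
    have e2 : 2 * (lam * (Aν : ℂ) + 2 * Real.pi * I * (Bq : ℂ)) = 4 * Real.pi * (sΔ : ℂ) := by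
      rw [hlam]
      linear_combination (2 * ((sΔ : ℂ) - I * (Bq : ℂ))) * hkA
    rw [e1, hAνC, hBqC, e2]
    have hπ : (Real.pi : ℂ) ≠ 0 := by exact_mod_cast Real.pi_pos.ne'
    have hs : (sΔ : ℂ) ≠ 0 := by exact_mod_cast hsΔpos.ne'
    exact mul_ne_zero (mul_ne_zero (by norm_num) hπ) hs
  obtain ⟨x, L, hxH, hx⟩ := exists_expPoint_hypersurfaceEscape H (by rw [hHdeg]; norm_num) ν q lam
    hre hroot hβ c hc S hS A
  refine ⟨x, L, ?_, hx⟩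
  rw [← hevalH x, hxH]

end Summit.Schanuel.Schanuel.Theorems
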